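import Summits.RiemannHypothesis.RiemannHypothesis.Theorems.Splittings.LiOneSidedCriteria
import HarnessLib

/-!
# Splittings — Li bridge lens, ONE-SIDED SUB-EXPONENTIAL ENVELOPES of `λ_n`, part 4/4: the CESÀRO rows (one-sided floors on
# partial sums `Σ λ_n/n`, `Σ λ_n`, either sign) as RH-EQUIVALENCES — SPLIT-li-bridge gen 4

Cell rh-split, seat rh-split-li-bridge g4 (brief sha16 f79c5f09d8bcb036), card
`run/shared/lean/pub/rh-split/cards/SPLIT-li-bridge.md` §11; zero-definition raw form of
`HOME/rh-split-li-bridge/SketchG4.lean` (sha16 00b14b55d9ac9472; referee rh-split-ref g2 verdict 2026-08-27T03:19:00Z: §11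
DELIVERABLE, farm rc 0 / 0 warn / 0 sorry, std axioms on `rh_iff_liSubexpUpper`, `rh_iff_liCesaroBddBelow`; CONTENT PRE-FILE
PASS «LiOneSidedCriteria{,Cesaro} zero-def carve (§11.3 excluded)»), filed by rh-split-typer-1 g4 in four parts
(`LiOneSidedCriteriaCore`, `LiOneSidedCriteriaTwist`, `LiOneSidedCriteria`, `LiOneSidedCriteriaCesaro`; the 400-line rule).
NOT CARRIED (card §11.3 = the scratch's file-§§8–9 progression rows, CONDITIONAL BOOKKEEPING on unprinted non-resonance):
the two defs `LiProgFloor` / `LiProgNonResonance` and `rh_of_nonResonance_progFloor`, `nonResonance_one`,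
`liPhi_ne_zero_of_rh` (tree: `Literature.NumberTheory.LFunctions.liPhi_ne_zero_of_rh`), `nonResonance_of_rh`,
`rh_iff_nonResonance_and_progFloor`.  The RH-free lemma `resonance_of_progFloor` is kept with `LiProgFloor σ q a` SPELLED OUT
(it is the engine of the `q = 1` criteria), and `rh_of_liFloor` is re-routed through it at `q = 1` (the scratch went through
`rh_of_nonResonance_progFloor` + `nonResonance_one`; same argument, `Finset.range 1` has no `j ≠ 0`).  Proofs otherwise verbatim;
docstrings added where the scratch had none.
HONEST LABEL: «SPLITTING SEARCH over kernel-typed RH-EQUIVALENCES; a splitting A ∧ B ⟹ RH is CONDITIONAL bookkeeping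
unless A and B are both proved; nothing here bears on the truth of RH.»  Every theorem below is an RH-EQUIVALENCE (neither side
asserted) or an RH-FREE implication whose hypothesis is of RH strength; `Summit.RiemannHypothesis` appears only as a
conclusion of such implications or as a hypothesis.

This part (referee g2 03:19:00Z: «Cesàro iffs = NEW KERNEL RH-EQUIVALENT CRITERIA, FIN-free»):
* §12 CESÀRO core (`cesaro_core`): a logarithm `ℓ` of `φ` on the least-modulus disc, partial sums `t_N = Σ_{1≤n≤N} λ_n/n` with a
  one-sided floor `σ t_N ≥ -d_N` (`Σ d_N r₀^N < ∞`) — contradiction via `T(w) = (ℓ(w) - ℓ(0))/(1 - w) = Σ t_N w^N` and modulus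
  domination; the weighted criterion `rh_of_liLogCesaroFloor`, discrete Abel summation (`abel_floor`), the plain criterion
  `rh_of_liCesaroFloor`, corollaries `rh_of_liCesaroBddBelow` («partial sums of `λ_n` bounded below ⟹ RH»), `rh_of_liCesaroUpper`,
  and `rh_iff_liCesaroBddBelow`;
* §13 converses: `liCesaroUpper_of_rh`, `rh_iff_liCesaroUpper`, `rh_iff_liLogCesaroBddBelow`.
-/

set_option linter.dupNamespace false

noncomputable section

open Complex Filter Topology Finset
open scoped Nat Real ComplexOrder ComplexConjugate

namespace Summit.RiemannHypothesis.RiemannHypothesis.Theorems.Splittings.LiOneSidedCriteria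

open Literature.NumberTheory.LFunctions
open Summit.RiemannHypothesis.RiemannHypothesis.Theorems.Splittings
open Summit.RiemannHypothesis.RiemannHypothesis.Theorems.Splittings.LiProgression

/-! ## 12. CESÀRO: one-sided floors on partial sums (weighted `Σ λ_n/n`, plain `Σ λ_n`) ⟹ RH -/

/-- `Σ_{n ∈ Icc 1 N} g n = Σ_{i < N} g (i+1)`. -/
private theorem sum_Icc_eq_sum_range (g : ℕ → ℝ) (N : ℕ) :
    ∑ m ∈ Finset.Icc 1 N, g m = ∑ i ∈ Finset.range N, g (i + 1) := by
  rw [← Finset.Ico_add_one_right_eq_Icc, Finset.sum_Ico_eq_sum_range, Nat.add_sub_cancel]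
  simp_rw [add_comm 1]

/-- **Cesàro core.** `ℓ` a logarithm of `φ` on the least-modulus disc `|w| < r₀ = |z₀|`, `φ(z₀) = 0`;
the partial sums `t_N = Σ_{1≤n≤N} λ_n/n` satisfy a one-sided floor `σ t_N ≥ -d_N` (`N ≥ N₀`) with
`Σ d_N r₀^N < ∞`.  Contradiction — via `T(w) = (ℓ(w) - ℓ(0))/(1 - w) = Σ t_N w^N` and modulus domination. -/
theorem cesaro_core {ℓ : ℂ → ℂ} {N₀ : ℕ} {r₀ : ℝ} (hr₀ : 0 < r₀) (hr₁ : r₀ < 1)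
    (hfree : ∀ z ∈ Metric.ball (0 : ℂ) r₀, liPhi z ≠ 0)
    {z₀ : ℂ} (hz₀ : ‖z₀‖ = r₀) (hfz₀ : liPhi z₀ = 0)
    (hℓ : DifferentiableOn ℂ ℓ (Metric.ball 0 r₀))
    (hfl : ∀ z ∈ Metric.ball (0 : ℂ) r₀, liPhi z = exp (ℓ z))
    {d : ℕ → ℝ} (hd : ∀ n, 0 ≤ d n) (hdsum : Summable fun n ↦ d n * r₀ ^ n)
    {σ : ℝ} (hσ : σ = 1 ∨ σ = -1)
    (hpos : ∀ N, N₀ ≤ N → -d N ≤ σ * ∑ n ∈ Finset.Icc 1 N, keiperLiCoeff n / n) : False := by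
  -- the coefficient sequence `t_N`
  set t : ℕ → ℂ := fun N ↦ ((∑ n ∈ Finset.Icc 1 N, keiperLiCoeff n / n : ℝ) : ℂ) with ht
  have htayl : ∀ N : ℕ, (∑ n ∈ Finset.range (N + 1), (n ! : ℂ)⁻¹ * iteratedDeriv n ℓ 0) = ℓ 0 + t N := by
    intro N
    rw [Finset.sum_range_succ', Nat.factorial_zero, Nat.cast_one, inv_one, one_mul, iteratedDeriv_zero,
      add_comm, ht]
    simp only
    rw [sum_Icc_eq_sum_range, Complex.ofReal_sum]
    congr 1
    refine Finset.sum_congr rfl fun i _ ↦ ?_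
    rw [taylorCoeff_eq hr₀ hℓ hfl (by omega : 1 ≤ i + 1)]
  -- `HasSum (t N w^N) ((ℓ w - ℓ 0)/(1-w))` on the disc
  have hT : ∀ w : ℂ, ‖w‖ < r₀ → HasSum (fun N ↦ t N * w ^ N) ((ℓ w - ℓ 0) * (1 - w)⁻¹) := by
    intro w hw
    have hw1 : ‖w‖ < 1 := hw.trans hr₁
    have h1 := hasSum_partialSums hℓ hr₁.le hw
    have h2 := (hasSum_geometric_of_norm_lt_one hw1).mul_left (ℓ 0)
    have h3 := h1.sub h2
    have hfun : (fun N ↦ t N * w ^ N) = fun N ↦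
        (∑ n ∈ Finset.range (N + 1), (n ! : ℂ)⁻¹ * iteratedDeriv n ℓ 0) * w ^ N - ℓ 0 * w ^ N := by
      funext N
      rw [htayl]
      ring
    rw [hfun, show (ℓ w - ℓ 0) * (1 - w)⁻¹ = ℓ w * (1 - w)⁻¹ - ℓ 0 * (1 - w)⁻¹ by ring]
    exact h3
  have hpos' : ∀ N, N₀ ≤ N → (t N).im = 0 ∧ -d N ≤ σ * (t N).re := fun N hN ↦ by
    simp only [ht, Complex.ofReal_im, Complex.ofReal_re]
    exact ⟨trivial, hpos N hN⟩
  -- segment bound at the positive real point `r₀`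
  have hR : liPhi ((r₀ : ℝ) : ℂ) ≠ 0 := liPhi_ofReal_ne_zero r₀
  obtain ⟨M, hM⟩ := segment_bound hr₀ hr₁ differentiableOn_liPhi hℓ hfl
    (p := ((r₀ : ℝ) : ℂ)) (by rw [Complex.norm_real, Real.norm_eq_abs, abs_of_pos hr₀]) hR
  set D₀ : ℝ := ∑' n, d n * r₀ ^ n with hD₀
  have h1r : 0 < 1 - r₀ := by linarith
  refine endgame hr₀ hr₁ differentiableOn_liPhi hfree hz₀ hfz₀
    (D := 2 * ((M + ‖ℓ 0‖) / (1 - r₀) + 2 * ∑ n ∈ Finset.range N₀, ‖t n‖ + 2 * D₀) + ‖ℓ 0‖)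
    fun u hu ↦ ?_
  obtain ⟨hu0, hu1⟩ := hu
  set w : ℂ := u * z₀ with hw
  have hwn : ‖w‖ = u * r₀ := by
    rw [hw, norm_mul, Complex.norm_real, Real.norm_eq_abs, abs_of_nonneg hu0, hz₀]
  have hwr : ‖w‖ < r₀ := by rw [hwn]; nlinarith
  have hwball : w ∈ Metric.ball (0 : ℂ) r₀ := by rwa [Metric.mem_ball, dist_zero_right]
  have hw1 : ‖w‖ ≤ 1 := by linarith
  have hwr' : ‖(((‖w‖ : ℝ)) : ℂ)‖ < r₀ := by
    rw [Complex.norm_real, Real.norm_eq_abs, abs_norm]; exact hwr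
  -- domination
  obtain ⟨hdw, hDw⟩ := slack_le hd hdsum (norm_nonneg w) hwr.le
  have hA := hT w hwr
  have hB := hT _ hwr'
  have hdom := norm_le_of_hasSum hσ hd hpos' hw1 hA hB hdw.hasSum
  -- the real point: `‖B‖ ≤ (M + ‖ℓ 0‖)/(1 - r₀)`
  have hBn : σ * ((ℓ ((‖w‖ : ℝ) : ℂ) - ℓ 0) * (1 - ((‖w‖ : ℝ) : ℂ))⁻¹).re ≤ (M + ‖ℓ 0‖) / (1 - r₀) := by
    set B : ℂ := (ℓ ((‖w‖ : ℝ) : ℂ) - ℓ 0) * (1 - ((‖w‖ : ℝ) : ℂ))⁻¹ with hBdef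
    have hσB : σ * B.re ≤ ‖B‖ := by
      have h := Complex.abs_re_le_norm B
      rcases hσ with rfl | rfl
      · rw [one_mul]; exact (le_abs_self _).trans h
      · rw [neg_one_mul]; exact (neg_le_abs _).trans h
    refine hσB.trans ?_
    have hℓw : ‖ℓ ((‖w‖ : ℝ) : ℂ)‖ ≤ M := by
      have e : ((‖w‖ : ℝ) : ℂ) = ((u : ℝ) : ℂ) * ((r₀ : ℝ) : ℂ) := by rw [hwn]; push_cast; ring
      rw [e]; exact hM u ⟨hu0, hu1⟩
    have hden : 1 - r₀ ≤ ‖1 - ((‖w‖ : ℝ) : ℂ)‖ := by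
      have e : (1 : ℂ) - ((‖w‖ : ℝ) : ℂ) = (((1 - ‖w‖ : ℝ)) : ℂ) := by push_cast; ring
      rw [e, Complex.norm_real, Real.norm_eq_abs, abs_of_nonneg (by linarith)]
      linarith
    rw [hBdef, norm_mul, norm_inv]
    have hnum : ‖ℓ ((‖w‖ : ℝ) : ℂ) - ℓ 0‖ ≤ M + ‖ℓ 0‖ :=
      (norm_sub_le _ _).trans (by linarith)
    have hM0 : 0 ≤ M + ‖ℓ 0‖ := by
      have := (norm_nonneg _).trans hℓw
      positivity
    have hinv : ‖1 - ((‖w‖ : ℝ) : ℂ)‖⁻¹ ≤ (1 - r₀)⁻¹ := inv_anti₀ h1r hden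
    calc ‖ℓ ((‖w‖ : ℝ) : ℂ) - ℓ 0‖ * ‖1 - ((‖w‖ : ℝ) : ℂ)‖⁻¹
        ≤ (M + ‖ℓ 0‖) * (1 - r₀)⁻¹ :=
          mul_le_mul hnum hinv (inv_nonneg.2 (norm_nonneg _)) hM0
      _ = (M + ‖ℓ 0‖) / (1 - r₀) := by rw [div_eq_mul_inv]
  -- the point `w`: `‖A‖ ≥ (‖ℓ w‖ - ‖ℓ 0‖)/2 ≥ (-log|φ w| - ‖ℓ 0‖)/2`
  have hAn : -Real.log ‖liPhi w‖ - ‖ℓ 0‖ ≤ 2 * ‖(ℓ w - ℓ 0) * (1 - w)⁻¹‖ := by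
    have hlog : -Real.log ‖liPhi w‖ ≤ ‖ℓ w‖ := by
      rw [hfl w hwball, Complex.norm_exp]
      rw [Real.log_exp]
      have := Complex.abs_re_le_norm (ℓ w)
      exact (neg_le_abs _).trans this
    have hden : ‖1 - w‖ ≤ 2 := by
      calc ‖1 - w‖ ≤ ‖(1 : ℂ)‖ + ‖w‖ := norm_sub_le _ _
        _ ≤ 1 + 1 := by rw [norm_one]; exact add_le_add le_rfl hw1
        _ = 2 := by norm_num
    have hden0 : 0 < ‖1 - w‖ := by
      refine norm_pos_iff.2 (sub_ne_zero.2 fun e ↦ ?_)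
      have : ‖w‖ = 1 := by rw [← e]; simp
      linarith
    have hsub : ‖ℓ w‖ - ‖ℓ 0‖ ≤ ‖ℓ w - ℓ 0‖ := by
      have := norm_sub_norm_le (ℓ w) (ℓ 0); linarith [abs_le.1 (abs_norm_sub_norm_le (ℓ w) (ℓ 0))]
    rw [norm_mul, norm_inv]
    have h3 : ‖ℓ w - ℓ 0‖ ≤ 2 * (‖ℓ w - ℓ 0‖ * ‖1 - w‖⁻¹) := by
      rw [show 2 * (‖ℓ w - ℓ 0‖ * ‖1 - w‖⁻¹) = ‖ℓ w - ℓ 0‖ * (2 / ‖1 - w‖) by ring]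
      exact le_mul_of_one_le_right (norm_nonneg _) ((one_le_div hden0).2 hden)
    linarith
  linarith [hdom, hBn, hAn, hDw]

/-- **Weighted Cesàro criterion, either sign.** If for every `ε > 0`,
`σ Σ_{n≤N} λ_n/n ≥ -C(ε) e^{εN}` for all large `N`, then RH. -/
theorem rh_of_liLogCesaroFloor {σ : ℝ} (hσ : σ = 1 ∨ σ = -1)
    (h : ∀ ε : ℝ, 0 < ε → ∃ C : ℝ, ∃ N₀ : ℕ, ∀ N : ℕ, N₀ ≤ N →
      -C * Real.exp (ε * N) ≤ σ * ∑ n ∈ Finset.Icc 1 N, keiperLiCoeff n / n) :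
    Summit.RiemannHypothesis := by
  refine riemannHypothesis_of_liPhi_ne_zero fun z₁ hz₁ hz₁0 ↦ ?_
  obtain ⟨z₀, hz₀ball, hz₀pos, hz₀0, hfree⟩ := exists_least_zero hz₁ hz₁0
  have hz₀1 : ‖z₀‖ < 1 := by rwa [Metric.mem_ball, dist_zero_right] at hz₀ball
  have hfree' : ∀ z ∈ Metric.ball (0 : ℂ) ‖z₀‖, liPhi z ≠ 0 := fun z hz ↦
    hfree z (by rwa [Metric.mem_ball, dist_zero_right] at hz)
  obtain ⟨ℓ, hℓ, hfl⟩ := exists_log_liPhi hz₀1.le hfree'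
  obtain ⟨hε, hρ0, hρ1⟩ := exp_eps_mul_lt_one hz₀pos hz₀1
  obtain ⟨C, N₀, hN₀⟩ := h _ hε
  have hd : ∀ n : ℕ, 0 ≤ |C| * Real.exp (-Real.log ‖z₀‖ / 2 * n) := fun n ↦ by positivity
  refine cesaro_core hz₀pos hz₀1 hfree' rfl hz₀0 hℓ hfl hd (summable_slack hρ0 hρ1) hσ
    (N₀ := N₀) fun N hN ↦ ?_
  have h1 := hN₀ N hN
  have h2 : -|C| * Real.exp (-Real.log ‖z₀‖ / 2 * N) ≤ -C * Real.exp (-Real.log ‖z₀‖ / 2 * N) :=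
    mul_le_mul_of_nonneg_right (neg_le_neg (le_abs_self C)) (Real.exp_pos _).le
  linarith

/-- **Discrete Abel summation, one-sided.** If `σ Σ_{n≤N} x_n ≥ -m_N` for all `N ≥ 1` with `m`
non-decreasing, then `σ Σ_{n≤N} x_n/n ≥ -m_N` for all `N ≥ 1`. -/
theorem abel_floor {x : ℕ → ℝ} {m : ℕ → ℝ} {σ : ℝ} (hmono : Monotone m)
    (hs : ∀ N, 1 ≤ N → -m N ≤ σ * ∑ n ∈ Finset.Icc 1 N, x n) :
    ∀ N, 1 ≤ N → -m N ≤ σ * ∑ n ∈ Finset.Icc 1 N, x n / n := by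
  -- strengthened induction: `σ (T_N - S_N/N) ≥ -m_N (1 - 1/N)`
  have key : ∀ N, 1 ≤ N →
      -m N * (1 - 1 / N) ≤ σ * (∑ n ∈ Finset.Icc 1 N, x n / n - (∑ n ∈ Finset.Icc 1 N, x n) / N) := by
    intro N hN
    induction N, hN using Nat.le_induction with
    | base => simp
    | succ k hk ih =>
      have hk0 : (0 : ℝ) < k := by exact_mod_cast hk
      have hk1 : (0 : ℝ) < (k : ℝ) + 1 := by linarith
      rw [Finset.sum_Icc_succ_top (by omega), Finset.sum_Icc_succ_top (by omega)]
      set S : ℝ := ∑ n ∈ Finset.Icc 1 k, x n with hS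
      set T : ℝ := ∑ n ∈ Finset.Icc 1 k, x n / n with hT
      have hsk := hs k hk
      rw [← hS] at hsk
      push_cast
      -- algebra: T + x/(k+1) - (S + x)/(k+1) = (T - S/k) + S/(k(k+1))
      have e : σ * (T + x (k + 1) / ((k : ℝ) + 1) - (S + x (k + 1)) / ((k : ℝ) + 1))
          = σ * (T - S / k) + σ * S / (k * ((k : ℝ) + 1)) := by
        field_simp
        ring
      rw [e]
      have h1 : -m k / (k * ((k : ℝ) + 1)) ≤ σ * S / (k * ((k : ℝ) + 1)) :=
        div_le_div_of_nonneg_right (by linarith) (by positivity)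
      have hmk := hmono (Nat.le_succ k)
      have hfac : 0 ≤ 1 - 1 / ((k : ℝ) + 1) := by
        rw [sub_nonneg, div_le_one hk1]; linarith
      have h2 : -m (k + 1) * (1 - 1 / ((k : ℝ) + 1)) ≤ -m k * (1 - 1 / ((k : ℝ) + 1)) := by
        nlinarith
      have e2 : -m k * (1 - 1 / ((k : ℝ) + 1)) = -m k * (1 - 1 / k) + -m k / (k * ((k : ℝ) + 1)) := by
        field_simp
        ring
      linarith [ih, h1, h2, e2]
  intro N hN
  have hN0 : (0 : ℝ) < N := by exact_mod_cast hN
  have h1 := key N hN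
  have h2 := hs N hN
  have h3 : -m N / N ≤ σ * (∑ n ∈ Finset.Icc 1 N, x n) / N :=
    div_le_div_of_nonneg_right h2 hN0.le
  have e : -m N = -m N * (1 - 1 / N) + -m N / N := by field_simp; ring
  have e2 : σ * ∑ n ∈ Finset.Icc 1 N, x n / n
      = σ * (∑ n ∈ Finset.Icc 1 N, x n / n - (∑ n ∈ Finset.Icc 1 N, x n) / N)
        + σ * (∑ n ∈ Finset.Icc 1 N, x n) / N := by ring
  rw [e, e2]
  exact add_le_add h1 h3

/-- **Plain Cesàro criterion, either sign.** If for every `ε > 0`, `σ Σ_{n≤N} λ_n ≥ -C(ε) e^{εN}` for all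
large `N`, then RH.  (`σ = 1`, `C` independent of `ε`: «partial sums of `λ_n` bounded below ⟹ RH».) -/
theorem rh_of_liCesaroFloor {σ : ℝ} (hσ : σ = 1 ∨ σ = -1)
    (h : ∀ ε : ℝ, 0 < ε → ∃ C : ℝ, ∃ N₀ : ℕ, ∀ N : ℕ, N₀ ≤ N →
      -C * Real.exp (ε * N) ≤ σ * ∑ n ∈ Finset.Icc 1 N, keiperLiCoeff n) :
    Summit.RiemannHypothesis := by
  have hσabs : |σ| = 1 := by rcases hσ with rfl | rfl <;> simp
  refine rh_of_liLogCesaroFloor hσ fun ε hε ↦ ?_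
  obtain ⟨C, N₀, hN₀⟩ := h ε hε
  -- a floor valid for ALL `N ≥ 1`, with a non-decreasing slack `m_N = C' e^{εN}`
  set H : ℝ := ∑ n ∈ Finset.Icc 1 N₀, |keiperLiCoeff n| with hH
  have hH0 : 0 ≤ H := Finset.sum_nonneg fun n _ ↦ abs_nonneg _
  set C' : ℝ := |C| + H with hC'
  have hC'0 : 0 ≤ C' := by positivity
  have hall : ∀ N : ℕ, 1 ≤ N →
      -(C' * Real.exp (ε * (N : ℝ))) ≤ σ * ∑ n ∈ Finset.Icc 1 N, keiperLiCoeff n := by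
    intro N hN
    have hexp1 : 1 ≤ Real.exp (ε * (N : ℝ)) := Real.one_le_exp (by positivity)
    have hexp0 := Real.exp_pos (ε * (N : ℝ))
    have hCe : C' * Real.exp (ε * (N : ℝ)) = |C| * Real.exp (ε * (N : ℝ)) + H * Real.exp (ε * (N : ℝ)) := by
      rw [hC']; ring
    have hHe : 0 ≤ H * Real.exp (ε * (N : ℝ)) := mul_nonneg hH0 hexp0.le
    have hC'e : C' * 1 ≤ C' * Real.exp (ε * (N : ℝ)) := mul_le_mul_of_nonneg_left hexp1 hC'0
    by_cases hNN : N₀ ≤ N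
    · have h1 := hN₀ N hNN
      have h2 : -|C| * Real.exp (ε * (N : ℝ)) ≤ -C * Real.exp (ε * (N : ℝ)) :=
        mul_le_mul_of_nonneg_right (neg_le_neg (le_abs_self C)) hexp0.le
      linarith
    · push Not at hNN
      have hsub : Finset.Icc 1 N ⊆ Finset.Icc 1 N₀ := Finset.Icc_subset_Icc_right hNN.le
      have hb : |σ * ∑ n ∈ Finset.Icc 1 N, keiperLiCoeff n| ≤ H := by
        rw [abs_mul, hσabs, one_mul]
        refine (Finset.abs_sum_le_sum_abs _ _).trans ?_
        exact Finset.sum_le_sum_of_subset_of_nonneg hsub fun n _ _ ↦ abs_nonneg _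
      have := (abs_le.1 hb).1
      linarith [abs_nonneg C]
  have hmono : Monotone fun N : ℕ ↦ C' * Real.exp (ε * N) := by
    intro a b hab
    exact mul_le_mul_of_nonneg_left (Real.exp_le_exp.2 (by
      have : (a : ℝ) ≤ b := by exact_mod_cast hab
      nlinarith)) hC'0
  have hA := abel_floor (x := keiperLiCoeff) (m := fun N : ℕ ↦ C' * Real.exp (ε * N)) hmono hall
  refine ⟨C', 1, fun N hN ↦ ?_⟩
  have := hA N hN
  beta_reduce at this
  linarith

/-- Corollary: **partial sums of `λ_n` bounded below ⟹ RH**. -/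
theorem rh_of_liCesaroBddBelow (h : ∃ K : ℝ, ∀ N : ℕ, 1 ≤ N → -K ≤ ∑ n ∈ Finset.Icc 1 N, keiperLiCoeff n) :
    Summit.RiemannHypothesis := by
  obtain ⟨K, hK⟩ := h
  refine rh_of_liCesaroFloor (σ := 1) (Or.inl rfl) fun ε hε ↦ ⟨|K|, 1, fun N hN ↦ ?_⟩
  have h1 := hK N hN
  have hexp1 : 1 ≤ Real.exp (ε * N) := Real.one_le_exp (by positivity)
  have : |K| ≤ |K| * Real.exp (ε * N) := le_mul_of_one_le_right (abs_nonneg _) hexp1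
  rw [one_mul]
  linarith [le_abs_self K]

/-- Corollary: **partial sums of `λ_n` bounded ABOVE sub-exponentially ⟹ RH**. -/
theorem rh_of_liCesaroUpper
    (h : ∀ ε : ℝ, 0 < ε → ∃ C : ℝ, ∃ N₀ : ℕ, ∀ N : ℕ, N₀ ≤ N →
      ∑ n ∈ Finset.Icc 1 N, keiperLiCoeff n ≤ C * Real.exp (ε * N)) : Summit.RiemannHypothesis := by
  refine rh_of_liCesaroFloor (σ := -1) (Or.inr rfl) fun ε hε ↦ ?_
  obtain ⟨C, N₀, hN₀⟩ := h ε hε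
  exact ⟨C, N₀, fun N hN ↦ by linarith [hN₀ N hN]⟩

/-- **RH ⟺ partial sums of `λ_n` bounded below.** RH-EQUIVALENT; neither side asserted. -/
theorem rh_iff_liCesaroBddBelow :
    Summit.RiemannHypothesis ↔ ∃ K : ℝ, ∀ N : ℕ, 1 ≤ N → -K ≤ ∑ n ∈ Finset.Icc 1 N, keiperLiCoeff n := by
  refine ⟨fun h ↦ ⟨0, fun N _ ↦ ?_⟩, rh_of_liCesaroBddBelow⟩
  rw [neg_zero]
  exact Finset.sum_nonneg fun n hn ↦ (li_criterion_holds.1 h) n (Finset.mem_Icc.1 hn).1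

/-! ## 13. Converses: the Cesàro rows as RH-EQUIVALENCES -/

/-- RH ⟹ the partial sums are bounded above sub-exponentially. -/
theorem liCesaroUpper_of_rh (hRH : Summit.RiemannHypothesis) :
    ∀ ε : ℝ, 0 < ε → ∃ C : ℝ, ∃ N₀ : ℕ, ∀ N : ℕ, N₀ ≤ N →
      ∑ n ∈ Finset.Icc 1 N, keiperLiCoeff n ≤ C * Real.exp (ε * N) := by
  intro ε hε
  obtain ⟨C, n₀, hn₀⟩ := liSubexpUpper_of_rh hRH (ε / 2) (by linarith)
  set H : ℝ := ∑ n ∈ Finset.range n₀, |keiperLiCoeff n| with hH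
  have hH0 : 0 ≤ H := Finset.sum_nonneg fun n _ ↦ abs_nonneg _
  refine ⟨H + |C| * (2 / ε), 1, fun N hN ↦ ?_⟩
  have hE0 : 0 < Real.exp (ε / 2 * N) := Real.exp_pos _
  -- pointwise: `λ_n ≤ [n < n₀]|λ_n| + |C| e^{(ε/2) N}` for `1 ≤ n ≤ N`
  have hpt : ∀ n ∈ Finset.Icc 1 N, keiperLiCoeff n ≤
      (if n < n₀ then |keiperLiCoeff n| else 0) + |C| * Real.exp (ε / 2 * N) := by
    intro n hn
    have hnN : n ≤ N := (Finset.mem_Icc.1 hn).2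
    have hCE : 0 ≤ |C| * Real.exp (ε / 2 * N) := by positivity
    by_cases h : n < n₀
    · rw [if_pos h]
      linarith [le_abs_self (keiperLiCoeff n)]
    · rw [if_neg h, zero_add]
      push Not at h
      have h1 := hn₀ n h
      have hnN' : (n : ℝ) ≤ N := by exact_mod_cast hnN
      have h2 : Real.exp (ε / 2 * n) ≤ Real.exp (ε / 2 * N) := Real.exp_le_exp.2 (by nlinarith)
      have h3 : C * Real.exp (ε / 2 * n) ≤ |C| * Real.exp (ε / 2 * n) :=
        mul_le_mul_of_nonneg_right (le_abs_self C) (Real.exp_pos _).le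
      have h4 : |C| * Real.exp (ε / 2 * n) ≤ |C| * Real.exp (ε / 2 * N) :=
        mul_le_mul_of_nonneg_left h2 (abs_nonneg C)
      linarith
  have hsum := Finset.sum_le_sum hpt
  rw [Finset.sum_add_distrib, Finset.sum_const, Nat.card_Icc, nsmul_eq_mul] at hsum
  have hcard : ((N + 1 - 1 : ℕ) : ℝ) = N := by rw [Nat.add_sub_cancel]
  rw [hcard] at hsum
  have hhead : ∑ n ∈ Finset.Icc 1 N, (if n < n₀ then |keiperLiCoeff n| else 0) ≤ H := by
    rw [← Finset.sum_filter]
    refine Finset.sum_le_sum_of_subset_of_nonneg (fun n hn ↦ ?_) fun n _ _ ↦ abs_nonneg _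
    rw [Finset.mem_filter] at hn
    exact Finset.mem_range.2 hn.2
  -- `N e^{(ε/2)N} ≤ (2/ε) e^{εN}`
  have hN2 : (N : ℝ) ≤ 2 / ε * Real.exp (ε / 2 * N) := by
    have h1 : ε / 2 * N + 1 ≤ Real.exp (ε / 2 * N) := Real.add_one_le_exp _
    rw [div_mul_eq_mul_div, le_div_iff₀ hε]
    nlinarith
  have hee : Real.exp (ε / 2 * N) * Real.exp (ε / 2 * N) = Real.exp (ε * N) := by
    rw [← Real.exp_add]; ring_nf
  have hexp1 : 1 ≤ Real.exp (ε * N) := Real.one_le_exp (by positivity)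
  have h5 : (N : ℝ) * (|C| * Real.exp (ε / 2 * N)) ≤ |C| * (2 / ε) * Real.exp (ε * N) := by
    rw [← hee]
    have := mul_le_mul_of_nonneg_right hN2 (by positivity : 0 ≤ |C| * Real.exp (ε / 2 * N))
    nlinarith
  have h6 : H ≤ H * Real.exp (ε * N) := le_mul_of_one_le_right hH0 hexp1
  nlinarith

/-- **RH ⟺ partial sums of `λ_n` bounded ABOVE sub-exponentially.** RH-EQUIVALENT; neither side asserted. -/
theorem rh_iff_liCesaroUpper :
    Summit.RiemannHypothesis ↔ ∀ ε : ℝ, 0 < ε → ∃ C : ℝ, ∃ N₀ : ℕ, ∀ N : ℕ, N₀ ≤ N →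
      ∑ n ∈ Finset.Icc 1 N, keiperLiCoeff n ≤ C * Real.exp (ε * N) :=
  ⟨liCesaroUpper_of_rh, rh_of_liCesaroUpper⟩

/-- **RH ⟺ weighted partial sums `Σ_{n≤N} λ_n/n` bounded below.** RH-EQUIVALENT; neither side asserted. -/
theorem rh_iff_liLogCesaroBddBelow :
    Summit.RiemannHypothesis ↔
      ∃ K : ℝ, ∀ N : ℕ, 1 ≤ N → -K ≤ ∑ n ∈ Finset.Icc 1 N, keiperLiCoeff n / n := by
  constructor
  · intro h
    refine ⟨0, fun N _ ↦ ?_⟩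
    rw [neg_zero]
    exact Finset.sum_nonneg fun n hn ↦ div_nonneg ((li_criterion_holds.1 h) n (Finset.mem_Icc.1 hn).1)
      (Nat.cast_nonneg _)
  · rintro ⟨K, hK⟩
    refine rh_of_liLogCesaroFloor (σ := 1) (Or.inl rfl) fun ε hε ↦ ⟨|K|, 1, fun N hN ↦ ?_⟩
    have h1 := hK N hN
    have hexp1 : 1 ≤ Real.exp (ε * N) := Real.one_le_exp (by positivity)
    have : |K| ≤ |K| * Real.exp (ε * N) := le_mul_of_one_le_right (abs_nonneg _) hexp1
    rw [one_mul]
    linarith [le_abs_self K]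

end Summit.RiemannHypothesis.RiemannHypothesis.Theorems.Splittings.LiOneSidedCriteria

end
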